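import Summits.Parity.BatemanHorn.Theorems.SoloInformedMoebiusLogPow
import Summits.Parity.BatemanHorn.Theorems.SoloInformedSystemPsiK

/-!
# SoloInformedPsiKMoebiusForm — `ψ_{k,f}(x) = (-1)ᵏ ∑_{n ≤ x} ∑_{e ∣ F(n)} μ(e) logᵏ e + o(x)` for every Bateman–Horn system

Solo unit `solo-Parity-informed` (ideation tier, informed mode), session 17; `PLAN.md` §25.2, CLAIMS C78.

For a Bateman–Horn system `f : ι → ℤ[X]` (`k = card ι ≥ 1`, `F = ∏ fᵢ`) write
`A_k(m) := ∑_{e ∣ m} μ(e) (log e)ᵏ`.  By `SoloInformedMoebiusLogPow`, `Λ_k(m) = (-1)ᵏ A_k(m)` as soon as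
`ω(m) ≥ k`.  Along the values `m = |F(n)|` this fails only at EXCEPTIONAL `n`: beyond the separation bound `P`
of the system (primes `> P` divide at most one `fᵢ(n)`), `ω(|F(n)|) < k` forces some `|fᵢ(n)|` to have all its
prime factors `≤ P` (`card_le_card_primeFactors_prod`), and such `n ≤ x` are `o(x / logʲ x)` for every `j`
(`SoloInformedSmoothValues`), while `|Λ_k(|F(n)|) - (-1)ᵏ A_k(|F(n)|)| ≤ (1 + 2ᵏ) logᵏ |F(n)| ≪ logᵏ x`.  Hence

* `isLittleO_psiK_sub_moebiusLogPowSum` —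
  `∑_{n ≤ x} Λ_k(|F(n)|) - (-1)ᵏ ∑_{n ≤ x} ∑_{e ∣ |F(n)|} μ(e) (log e)ᵏ = o(x)`.

With `SoloInformedSystemPsiK` (`BH(f) ⟺ ψ_{k,f}(x) ~ k! C(f) x`) this puts the conjunct, system by system, on the
single Möbius sum `∑_{n ≤ x} ∑_{e ∣ F(n)} μ(e) logᵏ e`, which `SoloInformedLargeDivisorsSystem` splits at
`e ≤ x^{1-ε}` / `e > x^{1-ε}`.
-/

namespace Summit.Parity.BatemanHorn.Theorems

open Finset Filter ArithmeticFunction Asymptotics Polynomial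
open scoped ArithmeticFunction.Moebius Topology
open Literature.NumberTheory.Sieve (IsBatemanHornSystem generalizedVonMangoldt generalizedVonMangoldt_le
  generalizedVonMangoldt_nonneg)

variable {ι : Type*} [Fintype ι]

/-- If primes `> P` divide at most one of the non-zero `m i` and NO `m i` has all its prime factors `≤ P`,
then `∏ m i` has at least `card ι` prime factors. -/
theorem card_le_card_primeFactors_prod {m : ι → ℕ} (hm : ∀ i, m i ≠ 0) {P : ℕ}
    (hsep : ∀ q : ℕ, q.Prime → P < q → ∀ i j, i ≠ j → ¬ (q ∣ m i ∧ q ∣ m j))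
    (hrough : ∀ i, ∃ q ∈ (m i).primeFactors, P < q) :
    Fintype.card ι ≤ (∏ i, m i).primeFactors.card := by
  classical
  choose q hqmem hqP using hrough
  have hqprime : ∀ l, (q l).Prime := fun l => Nat.prime_of_mem_primeFactors (hqmem l)
  have hqdvd : ∀ l, q l ∣ m l := fun l => Nat.dvd_of_mem_primeFactors (hqmem l)
  have hinj : Function.Injective q := by
    intro i j h
    by_contra hij
    exact hsep (q i) (hqprime i) (hqP i) i j hij ⟨hqdvd i, h ▸ hqdvd j⟩
  have hne : ∏ i, m i ≠ 0 := prod_ne_zero_iff.mpr fun i _ => hm i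
  have himg : univ.image q ⊆ (∏ i, m i).primeFactors := by
    intro p hp
    obtain ⟨l, -, rfl⟩ := mem_image.mp hp
    exact Nat.mem_primeFactors.mpr ⟨hqprime l, (hqdvd l).trans (dvd_prod_of_mem m (mem_univ l)), hne⟩
  calc Fintype.card ι = (univ.image q).card := by rw [card_image_of_injective _ hinj, card_univ]
    _ ≤ _ := card_le_card himg

/-- Pointwise: `|Λ_k(M) - (-1)ᵏ ∑_{e ∣ M} μ(e) logᵏ e| ≤ (1 + 2ᵏ) (log M)ᵏ` when `ω(M) ≤ k`, `M ≠ 0`, `k ≥ 1`. -/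
theorem abs_generalizedVonMangoldt_sub_moebiusLogPow_le {M k : ℕ} (hM : M ≠ 0) (hk : 0 < k)
    (hω : M.primeFactors.card ≤ k) :
    |generalizedVonMangoldt k M - (-1 : ℝ) ^ k * ∑ e ∈ M.divisors, (μ e : ℝ) * Real.log e ^ k|
      ≤ (1 + 2 ^ k) * Real.log M ^ k := by
  have hlog0 : 0 ≤ Real.log (M : ℝ) := Real.log_natCast_nonneg M
  have h1 : |generalizedVonMangoldt k M| ≤ Real.log M ^ k := by
    rw [abs_of_nonneg (generalizedVonMangoldt_nonneg _ _)]
    exact generalizedVonMangoldt_le hk _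
  have h2 : |(-1 : ℝ) ^ k * ∑ e ∈ M.divisors, (μ e : ℝ) * Real.log e ^ k| ≤ 2 ^ k * Real.log M ^ k := by
    rw [abs_mul, abs_pow, abs_neg, abs_one, one_pow, one_mul]
    exact abs_sum_divisors_moebius_mul_log_pow_le' hM k k hω
  calc _ ≤ |generalizedVonMangoldt k M| + |(-1 : ℝ) ^ k * ∑ e ∈ M.divisors, (μ e : ℝ) * Real.log e ^ k| :=
        abs_sub _ _
    _ ≤ Real.log M ^ k + 2 ^ k * Real.log M ^ k := add_le_add h1 h2
    _ = (1 + 2 ^ k) * Real.log M ^ k := by ring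

open scoped Classical in
/-- **`ψ_{k,f}(x) - (-1)ᵏ ∑_{n ≤ x} ∑_{e ∣ |F(n)|} μ(e) (log e)ᵏ = o(x)`** for every Bateman–Horn system `f`
(`k = card ι ≥ 1`, `F = ∏ fᵢ`). -/
theorem isLittleO_psiK_sub_moebiusLogPowSum {f : ι → ℤ[X]} (hf : IsBatemanHornSystem f)
    (hk : 0 < Fintype.card ι) :
    (fun x : ℕ => ∑ n ∈ Icc 1 x, generalizedVonMangoldt (Fintype.card ι) ((∏ i, f i).eval (n : ℤ)).natAbs
        - (-1 : ℝ) ^ Fintype.card ι * ∑ n ∈ Icc 1 x,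
            ∑ e ∈ (((∏ i, f i).eval (n : ℤ)).natAbs).divisors, (μ e : ℝ) * Real.log e ^ Fintype.card ι)
      =o[atTop] fun x : ℕ => (x : ℝ) := by
  set k := Fintype.card ι with hkdef
  obtain ⟨P, N, hsep, hlarge⟩ := exists_sep_and_large hf
  set m : ι → ℕ → ℕ := fun i n => ((f i).eval (n : ℤ)).natAbs with hm
  set Mv : ℕ → ℕ := fun n => ((∏ i, f i).eval (n : ℤ)).natAbs with hMv
  set g : ℕ → ℝ := fun n => generalizedVonMangoldt k (Mv n)
    - (-1 : ℝ) ^ k * ∑ e ∈ (Mv n).divisors, (μ e : ℝ) * Real.log e ^ k with hg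
  have hlarge' : ∀ n, N ≤ n → ∀ i, P + 1 < m i n := fun n hn i => hlarge n hn i
  have hm0 : ∀ n, N ≤ n → ∀ i, m i n ≠ 0 := fun n hn i => by have := hlarge' n hn i; omega
  have hsep' : ∀ n : ℕ, ∀ q : ℕ, q.Prime → P < q → ∀ i j, i ≠ j → ¬ (q ∣ m i n ∧ q ∣ m j n) :=
    fun n q hq hPq i j hij => hsep q hq hPq i j hij n
  have hprod : ∀ n : ℕ, Mv n = ∏ i, m i n := by
    intro n
    simp only [hMv, hm]
    rw [eval_prod]
    exact map_prod Int.natAbsHom _ _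
  have hMv0 : ∀ n, N ≤ n → Mv n ≠ 0 := fun n hn => by
    rw [hprod n]; exact prod_ne_zero_iff.mpr fun i _ => hm0 n hn i
  -- beyond `N`, `g n ≠ 0` forces a `P`-smooth value, and then `ω(|F(n)|) < k`
  have hexc : ∀ n, N ≤ n → g n ≠ 0 →
      (∃ l, m l n ≠ 0 ∧ ∀ q ∈ (m l n).primeFactors, q ≤ P) ∧ (Mv n).primeFactors.card ≤ k := by
    intro n hn hgn
    have hlt : ¬ k ≤ (Mv n).primeFactors.card := by
      intro hω
      apply hgn
      simp only [hg, generalizedVonMangoldt_eq_neg_one_pow_mul_sum_divisors (hMv0 n hn) hω, sub_self]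
    refine ⟨?_, (not_le.mp hlt).le⟩
    by_contra hno
    push Not at hno
    have hrough : ∀ l, ∃ q ∈ (m l n).primeFactors, P < q := fun l => hno l (hm0 n hn l)
    exact hlt (by rw [hprod n]; exact card_le_card_primeFactors_prod (hm0 n hn) (hsep' n) hrough)
  -- size of the weights: `log |F(n)| ≤ (D + Bt) log x` on `[1, x]`
  choose B hB using fun i => exists_abs_log_natAbs_eval_sub_le (hf.natDegree_pos i)
  set D : ℝ := ∑ i, ((f i).natDegree : ℝ) with hD
  set Bt : ℝ := ∑ i, |B i| with hBt
  have hBt0 : 0 ≤ Bt := sum_nonneg fun i _ => abs_nonneg _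
  have hD0 : 0 ≤ D := sum_nonneg fun i _ => Nat.cast_nonneg _
  set c : ℝ := (1 + 2 ^ k) * (D + Bt) ^ k with hc
  have hc0 : 0 ≤ c := by positivity
  have hlogM : ∀ x n : ℕ, 1 ≤ Real.log x → n ∈ Icc 1 x → Real.log ((Mv n : ℕ) : ℝ) ≤ (D + Bt) * Real.log x := by
    intro x n hLx hn
    obtain ⟨hn1, hnx⟩ := mem_Icc.mp hn
    have hlogn : Real.log n ≤ Real.log x :=
      Real.log_le_log (by exact_mod_cast hn1) (by exact_mod_cast hnx)
    have hlogn0 : 0 ≤ Real.log n := Real.log_nonneg (by exact_mod_cast hn1)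
    have hsum : Real.log (((∏ i, m i n : ℕ) : ℝ)) ≤ ∑ i, Real.log ((m i n : ℕ) : ℝ) := by
      by_cases h0 : ∃ i, m i n = 0
      · obtain ⟨i, hi⟩ := h0
        rw [prod_eq_zero (mem_univ i) hi, Nat.cast_zero, Real.log_zero]
        exact sum_nonneg fun j _ => Real.log_natCast_nonneg _
      · push Not at h0
        rw [Nat.cast_prod, Real.log_prod]
        exact fun j _ => Nat.cast_ne_zero.mpr (h0 j)
    have heach : ∀ i, Real.log ((m i n : ℕ) : ℝ) ≤ (f i).natDegree * Real.log n + |B i| := by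
      intro i
      have := (abs_le.mp (hB i n hn1)).2
      linarith [le_abs_self (B i)]
    rw [hprod n]
    calc Real.log (((∏ i, m i n : ℕ) : ℝ)) ≤ ∑ i, Real.log ((m i n : ℕ) : ℝ) := hsum
      _ ≤ ∑ i, (((f i).natDegree : ℝ) * Real.log n + |B i|) := sum_le_sum fun i _ => heach i
      _ = D * Real.log n + Bt := by rw [sum_add_distrib, hD, hBt, sum_mul]
      _ ≤ D * Real.log x + Bt * Real.log x :=
          add_le_add (mul_le_mul_of_nonneg_left hlogn hD0) (le_mul_of_one_le_right hBt0 hLx)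
      _ = (D + Bt) * Real.log x := by ring
  have hg_le : ∀ x n : ℕ, 1 ≤ Real.log x → n ∈ Icc 1 x → N ≤ n → |g n| ≤ c * Real.log x ^ k := by
    intro x n hLx hn hNn
    by_cases hgn : g n = 0
    · rw [hgn, abs_zero]; exact mul_nonneg hc0 (pow_nonneg (by linarith) _)
    have hω := (hexc n hNn hgn).2
    have h0 : 0 ≤ Real.log ((Mv n : ℕ) : ℝ) := Real.log_natCast_nonneg _
    calc |g n| ≤ (1 + 2 ^ k) * Real.log ((Mv n : ℕ) : ℝ) ^ k :=
          abs_generalizedVonMangoldt_sub_moebiusLogPow_le (hMv0 n hNn) hk hω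
      _ ≤ (1 + 2 ^ k) * ((D + Bt) * Real.log x) ^ k :=
          mul_le_mul_of_nonneg_left (pow_le_pow_left₀ h0 (hlogM x n hLx hn) k) (by positivity)
      _ = c * Real.log x ^ k := by rw [hc, mul_pow]; ring
  have hident : ∀ x : ℕ, ∑ n ∈ Icc 1 x, generalizedVonMangoldt k (Mv n)
      - (-1 : ℝ) ^ k * ∑ n ∈ Icc 1 x, ∑ e ∈ (Mv n).divisors, (μ e : ℝ) * Real.log e ^ k
        = ∑ n ∈ Icc 1 x, g n := by
    intro x
    simp only [hg, sum_sub_distrib, mul_sum]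
  set C₁ : ℝ := ∑ n ∈ range N, |g n| with hC₁
  rw [isLittleO_iff]
  intro δ hδ
  have hkR : (0 : ℝ) < k := by exact_mod_cast hk
  set δ' : ℝ := δ / 2 / ((c + 1) * k) with hδ'
  have hδ'0 : 0 < δ' := by positivity
  have hSM : ∀ i, ∀ᶠ x : ℕ in atTop, (#((Icc 1 x).filter fun n : ℕ =>
      m i n ≠ 0 ∧ ∀ q ∈ (m i n).primeFactors, q ≤ P) : ℝ) * Real.log x ^ k ≤ δ' * x :=
    fun i => eventually_card_smoothValues_mul_log_pow_le (hf.natDegree_pos i) P k hδ'0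
  have hC₁x : ∀ᶠ x : ℕ in atTop, C₁ ≤ δ / 2 * x := by
    filter_upwards [(tendsto_natCast_atTop_atTop (R := ℝ)).eventually_ge_atTop (C₁ / (δ / 2))]
      with x hx
    rw [div_le_iff₀ (by positivity)] at hx
    linarith
  have hlog1 : ∀ᶠ x : ℕ in atTop, 1 ≤ Real.log x :=
    (Real.tendsto_log_atTop.comp tendsto_natCast_atTop_atTop).eventually_ge_atTop 1
  filter_upwards [Filter.eventually_all.mpr hSM, hC₁x, hlog1] with x hSMx hC₁x' hLx
  rw [hident x, Real.norm_eq_abs, Real.norm_eq_abs, Nat.abs_cast]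
  set S := Icc 1 x with hS
  set T := S.filter (fun n : ℕ => ¬ n < N) with hT
  set Bad := (univ : Finset ι).biUnion (fun i => S.filter fun n : ℕ =>
      m i n ≠ 0 ∧ ∀ q ∈ (m i n).primeFactors, q ≤ P) with hBad
  have hlow : ∑ n ∈ S.filter (fun n : ℕ => n < N), |g n| ≤ C₁ := by
    apply sum_le_sum_of_subset_of_nonneg
    · intro n hn
      exact mem_range.mpr (mem_filter.mp hn).2
    · exact fun n _ _ => abs_nonneg _
  have hT_pt : ∀ n ∈ T.filter (fun n => |g n| ≠ 0), |g n| ≤ c * Real.log x ^ k ∧ n ∈ Bad := by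
    intro n hn
    obtain ⟨hnT, hgn⟩ := mem_filter.mp hn
    obtain ⟨hnS, hnN⟩ := mem_filter.mp hnT
    have hNn : N ≤ n := not_lt.mp hnN
    have hgn' : g n ≠ 0 := fun h => hgn (by rw [h, abs_zero])
    refine ⟨hg_le x n hLx hnS hNn, ?_⟩
    obtain ⟨⟨l, hl0, hl⟩, -⟩ := hexc n hNn hgn'
    exact mem_biUnion.mpr ⟨l, mem_univ l, mem_filter.mpr ⟨hnS, hl0, hl⟩⟩
  have hckx : 0 ≤ c * Real.log x ^ k := mul_nonneg hc0 (pow_nonneg (by linarith) k)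
  have hhigh : ∑ n ∈ T, |g n| ≤ #Bad * (c * Real.log x ^ k) := by
    rw [← sum_filter_ne_zero T]
    calc ∑ n ∈ T.filter (fun n => |g n| ≠ 0), |g n|
        ≤ #(T.filter fun n => |g n| ≠ 0) • (c * Real.log x ^ k) :=
          sum_le_card_nsmul _ _ _ fun n hn => (hT_pt n hn).1
      _ ≤ #Bad • (c * Real.log x ^ k) :=
          nsmul_le_nsmul_left hckx (card_le_card fun n hn => (hT_pt n hn).2)
      _ = #Bad * (c * Real.log x ^ k) := nsmul_eq_mul _ _
  have hBadle : (#Bad : ℝ) ≤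
      ∑ i, (#(S.filter fun n : ℕ => m i n ≠ 0 ∧ ∀ q ∈ (m i n).primeFactors, q ≤ P) : ℝ) := by
    have h := card_biUnion_le (s := (univ : Finset ι))
      (t := fun i => S.filter fun n : ℕ => m i n ≠ 0 ∧ ∀ q ∈ (m i n).primeFactors, q ≤ P)
    rw [hBad]
    exact_mod_cast h
  have hsumSM : (∑ i, (#(S.filter fun n : ℕ => m i n ≠ 0 ∧ ∀ q ∈ (m i n).primeFactors, q ≤ P) : ℝ))
      * Real.log x ^ k ≤ k * (δ' * x) := by
    rw [sum_mul]
    refine (sum_le_sum fun i _ => hSMx i).trans ?_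
    rw [sum_const, card_univ, nsmul_eq_mul]
  have hx0 : (0 : ℝ) ≤ x := Nat.cast_nonneg x
  have hfin : c * (k * (δ' * x)) ≤ δ / 2 * x := by
    have e : c * (k * (δ' * x)) = c / (c + 1) * (δ / 2 * x) := by
      rw [hδ']
      field_simp
    rw [e]
    have h1 : c / (c + 1) ≤ 1 := by
      rw [div_le_one (by positivity)]
      linarith
    have h2 : 0 ≤ δ / 2 * x := by positivity
    nlinarith
  calc |∑ n ∈ S, g n|
      = |∑ n ∈ S.filter (fun n : ℕ => n < N), g n + ∑ n ∈ T, g n| := by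
        rw [sum_filter_add_sum_filter_not]
    _ ≤ ∑ n ∈ S.filter (fun n : ℕ => n < N), |g n| + ∑ n ∈ T, |g n| :=
        (abs_add_le _ _).trans (add_le_add (abs_sum_le_sum_abs _ _) (abs_sum_le_sum_abs _ _))
    _ ≤ C₁ + #Bad * (c * Real.log x ^ k) := add_le_add hlow hhigh
    _ ≤ δ / 2 * x + (∑ i, (#(S.filter fun n : ℕ => m i n ≠ 0 ∧ ∀ q ∈ (m i n).primeFactors, q ≤ P) : ℝ))
          * (c * Real.log x ^ k) := add_le_add hC₁x' (mul_le_mul_of_nonneg_right hBadle hckx)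
    _ = δ / 2 * x + c * ((∑ i, (#(S.filter fun n : ℕ =>
            m i n ≠ 0 ∧ ∀ q ∈ (m i n).primeFactors, q ≤ P) : ℝ)) * Real.log x ^ k) := by ring
    _ ≤ δ / 2 * x + c * (k * (δ' * x)) := by gcongr
    _ ≤ δ / 2 * x + δ / 2 * x := add_le_add le_rfl hfin
    _ = δ * x := by ring

end Summit.Parity.BatemanHorn.Theorems
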